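import Mathlib
import Summits.Langlands.Langlands.Theses.PhantomRMYoshida
import Summits.Langlands.Langlands.Theorems.PhantomRMYoshidaStableYoshidaCongruenceCharpolyCongruence
import Summits.Langlands.Langlands.Theorems.PhantomRMYoshidaStableYoshidaCongruenceDistinguishedTransferLocal
import Summits.Langlands.Langlands.Theorems.PhantomRMYoshidaStableYoshidaCongruenceTateModuleIrreducible
import Summits.Langlands.Langlands.Theorems.PhantomRMYoshidaStableYoshidaCongruenceTateModuleGreenberg
import Summits.Langlands.Langlands.Theorems.PhantomRMYoshidaStableYoshidaCongruenceSwitchToModularSurface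
import Literature.AlgebraicGeometry.Motives.FaltingsAbelian
import HarnessLib

/-!
# Route `PhantomRMYoshida`, crux `StableYoshidaCongruence` (stmt-Langlands-13640), line
# `level-three-weierstrass-switch`: the SECTOR THEOREM — the crux on the `p = 3` switchable sector,
# modulo five named facts

`stub_sectorModuloFacts` (registered stub of the checked skeleton, reshape v6): granted the five published facts
(Faltings 1983 Satz 3 and Satz 4 — tree `Literature.AlgebraicGeometry.Motives.isSemisimpleRepresentation_rationalTateRep`,
`faltings_tate_bijective`; the Serre–Tate ordinary filtration `Literature.NumberTheory.DiophantineGeometry.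
ordinaryReduction_tateModule_filtration`; the Boxer–Calegari–Gee–Pilloni `2`–`3` switch onto a modular abelian
surface `…bcgp_switch_exists_modular_abelianSurface`; the Weil pairing `…weilPairing_rationalTateModule`), the crux
`StableYoshidaCongruence` holds at every datum `(p, k, red, σ, σ')` of its SECTOR `p = 3 ∧ Switchable 3 k σ σ'`
(`σ ⊕ σ'` has a `GSp₄(𝔽₃)`-model that is symplectic-`ε̄⁻¹`, ordinary-with-unramified-sub and peu ramifié at `3`,
unramified at `2` off `4C/12C` — verbatim the hypotheses of arXiv:2502.20645 Lemma 9.4.2): the crux's body at those data (verbatim).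

This is the sorry-free composition of the line's LANDED stubs — `stub_switchToModularSurface` (the lever),
`stub_tateModuleIrreducible`, `stub_tateModuleGreenberg`, `stub_charpolyCongruence`, `stub_distinguishedTransferLocal` —
i.e. the in-sector branch of the skeleton's deciding theorem with the five `stub_fact_*` obligations turned into
explicit hypotheses.  What it does NOT cover is exactly the registered open stub `stub_offSectorRemainder` (the crux
off the sector), handed back to the planners (`promote-stub`).  The conclusion is `CruxAt 3 k red σ σ'` — the crux at fixed outer data
(Vocabulary I `invCyc`, `Sh`, `AutGL2`, `AutGL4`, `DetCond`, `NonConj`, `CruxAt`, `crux_iff : StableYoshidaCongruence ↔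
∀ p ≠ 2 …, CruxAt … := Iff.rfl`, copied VERBATIM from the checked skeleton = Disproof.lean §0; `epsBar`, `Switchable` and
Vocabulary II–III come with the imported Stub-2 file).  Lead prover-line-stmt-Langlands-13640-0, 2026-08-16.
-/

set_option linter.dupNamespace false

noncomputable section

open CategoryTheory IsDedekindDomain
open scoped NumberField
open Literature.NumberTheory.GaloisRepresentations Literature.NumberTheory.Automorphic
open Literature.AlgebraicGeometry.Motives (AbelianVariety)
open Literature.NumberTheory.DiophantineGeometry (weilPairing_rationalTateModule
  ordinaryReduction_tateModule_filtration bcgp_switch_exists_modular_abelianSurface)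
open Summit.Langlands.Langlands.Theses.PhantomRMYoshida

namespace Summit.Langlands.Langlands.Cruxes.StableYoshidaCongruence.LevelThreeWeierstrassSwitch

/-! ## Vocabulary I — the crux unfolded into named pieces (verbatim Disproof.lean §0) -/

section Names

variable (p : ℕ) [Fact p.Prime] (k : Type) [Field k] [CharP k p] [TopologicalSpace k]
  [DiscreteTopology k]

-- `epsBar` (the route's inline mod-`p` cyclotomic character) now comes with the imported Stub-2 module.

/-- The multiplier function `g ↦ ε(g)⁻¹ ∈ ℚ̄_p` of the route (cohomological convention). -/
def invCyc : Field.absoluteGaloisGroup ℚ → PadicAlgCl p := fun g =>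
  algebraMap ℚ_[p] (PadicAlgCl p)
    ((((GaloisRep.cyclotomicCharacter ℚ p g)⁻¹ : ℤ_[p]ˣ) : ℤ_[p]) : ℚ_[p])

variable {p k}

/-- `Sh red σ σ' r`: the SHAPE demanded by the crux — symplectic-`ε⁻¹`, Greenberg-ordinary
`(0,0,1,1)` and residually distinguished at `p`, residual pair `(σ, σ')` through `red`.  Verbatim the
route's `let Sh`; its third conjunct is literally `r.HasResidualPair red σ σ'`
(`Literature/NumberTheory/GaloisRepresentations/ResidualPair.lean`). -/
def Sh (red : Valued.integer (PadicAlgCl p) →+* k) (σ σ' : FramedGaloisRep ℚ k 2)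
    (r : FramedGaloisRep ℚ (PadicAlgCl p) 4) : Prop :=
  r.IsSymplecticWithMultiplierFun (invCyc p) ∧
  (∀ v : HeightOneSpectrum (NumberField.RingOfIntegers ℚ),
      ((p : ℕ) : NumberField.RingOfIntegers ℚ) ∈ v.asIdeal →
        r.IsGreenbergOrdinaryOfShapeAt v ![0, 0, 1, 1] ∧ r.IsResiduallyDistinguishedAt v ![0, 0, 1, 1]) ∧
  (∀ᶠ v : HeightOneSpectrum (NumberField.RingOfIntegers ℚ) in Filter.cofinite,
      r.IsUnramifiedAt v ∧ σ.IsUnramifiedAt v ∧ σ'.IsUnramifiedAt v ∧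
        ∃ (P : Polynomial (Valued.integer (PadicAlgCl p))) (P₁ P₂ : Polynomial k),
          r.HasFrobCharpolyAt v (P.map (Valued.integer (PadicAlgCl p)).subtype) ∧
            σ.HasFrobCharpolyAt v P₁ ∧ σ'.HasFrobCharpolyAt v P₂ ∧ P.map red = P₁ * P₂)

/-- `AutGL2 red s`: residual automorphy of `s : Γ_ℚ → GL₂(k)` on `GL₂` (verbatim the route's
`let AutGL2`; NOT consumed by this line — decoration modulo KW, Disproof §3.5). -/
def AutGL2 (red : Valued.integer (PadicAlgCl p) →+* k) (s : FramedGaloisRep ℚ k 2) : Prop :=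
  ∀ (hcpt₂ : isCompact_glFiniteIntegralLevel 2 ℚ) (ι : PadicAlgCl p ≃+* ℂ),
    ∃ π₂ : CuspidalAutomorphicRepData 2 ℚ hcpt₂, π₂.1.IsLAlgebraic ∧
      ∀ᶠ v : HeightOneSpectrum (NumberField.RingOfIntegers ℚ) in Filter.cofinite,
        ∃ (a : Multiset ℂ) (P : Polynomial (Valued.integer (PadicAlgCl p))) (Pb : Polynomial k),
          π₂.1.HasSatakeParamAt v a ∧
            P.map (Valued.integer (PadicAlgCl p)).subtype = arithFrobPolyOfSatake ι v.residueCard 1 a ∧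
              s.IsUnramifiedAt v ∧ s.HasFrobCharpolyAt v Pb ∧ P.map red = Pb

variable (p) in
/-- `AutGL4 hcpt ι r`: `r` is automorphic on `GL₄(𝔸_ℚ)` (the inlined `IsAutomorphicAE` clause). -/
def AutGL4 (hcpt : isCompact_glFiniteIntegralLevel 4 ℚ) (ι : PadicAlgCl p ≃+* ℂ)
    (r : FramedGaloisRep ℚ (PadicAlgCl p) 4) : Prop :=
  ∃ π : CuspidalAutomorphicRepData 4 ℚ hcpt, π.1.IsLAlgebraic ∧
    ∀ᶠ v : HeightOneSpectrum (NumberField.RingOfIntegers ℚ) in Filter.cofinite,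
      ∃ a : Multiset ℂ, π.1.HasSatakeParamAt v a ∧ r.IsUnramifiedAt v ∧
        r.HasFrobCharpolyAt v (arithFrobPolyOfSatake ι v.residueCard 1 a)

variable (p) in
/-- `DetCond σ σ'`: `det σ = ε̄⁻¹` and `det σ' = det σ`. -/
def DetCond (σ σ' : FramedGaloisRep ℚ k 2) : Prop :=
  ∀ g, FramedRep.det σ g = (Units.map (ZMod.castHom (dvd_refl p) k).toMonoidHom (epsBar p g))⁻¹ ∧
    FramedRep.det σ' g = FramedRep.det σ g

/-- `NonConj σ σ'`: `σ'` is not `GL₂(k)`-conjugate to `σ`. -/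
def NonConj (σ σ' : FramedGaloisRep ℚ k 2) : Prop :=
  ¬ ∃ g : GL (Fin 2) k, ∀ x, g * σ x * g⁻¹ = σ' x

variable (p k) in
/-- The crux AT fixed outer data `(p, k, red, σ, σ')`. -/
def CruxAt (red : Valued.integer (PadicAlgCl p) →+* k) (σ σ' : FramedGaloisRep ℚ k 2) : Prop :=
  AutGL2 red σ → AutGL2 red σ' → σ.toGaloisRep.IsIrreducible → σ'.toGaloisRep.IsIrreducible →
    DetCond p σ σ' → NonConj σ σ' → (∃ ρ : FramedGaloisRep ℚ (PadicAlgCl p) 4, Sh red σ σ' ρ) →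
      ∀ (hcpt : isCompact_glFiniteIntegralLevel 4 ℚ) (ι : PadicAlgCl p ≃+* ℂ),
        ∃ ρ₀ : FramedGaloisRep ℚ (PadicAlgCl p) 4,
          ρ₀.toGaloisRep.IsIrreducible ∧ Sh red σ σ' ρ₀ ∧ AutGL4 p hcpt ι ρ₀

end Names

/-- The crux is literally `∀ p ≠ 2, ∀ k red σ σ', CruxAt p k red σ σ'` (the route's `let`s
zeta-reduce to the named pieces; same `Iff.rfl` as Disproof.lean `crux_iff`). -/
theorem crux_iff :
    StableYoshidaCongruence ↔
      ∀ (p : ℕ) [Fact p.Prime], p ≠ 2 → ∀ (k : Type) [Field k] [CharP k p] [IsAlgClosed k]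
        [TopologicalSpace k] [DiscreteTopology k] (red : Valued.integer (PadicAlgCl p) →+* k)
        (σ σ' : FramedGaloisRep ℚ k 2), CruxAt p k red σ σ' :=
  Iff.rfl


/-! ## The sector theorem -/

/-- **The crux on the `p = 3` switchable sector, modulo five named facts** (registered stub
`stub_sectorModuloFacts`).  IN the sector: the 2–3 switch (`stub_switchToModularSurface`, from the BCGP and Weil
facts) produces a modular abelian surface `B` with framed `H¹ = ρ₀`, symplectic-`ε⁻¹`, residual pair `(σ, σ')`,
automorphic; the Tate-module dictionary (`stub_tateModuleIrreducible` from the Faltings facts,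
`stub_tateModuleGreenberg` from the Serre–Tate fact) makes `ρ₀` irreducible and Greenberg-ordinary `(0,0,1,1)` at `3`;
residual distinguishedness is transferred from the H5-witness (`stub_charpolyCongruence` +
`stub_distinguishedTransferLocal`); so `ρ₀` witnesses `CruxAt`.  `AutGL2`, `DetCond`, `NonConj` are not consumed.
[cite: BoxerCalegariGeePilloni2025, Lemma 9.4.2, Thm. 8.3.2, Thm. 9.5.2 (arXiv:2502.20645)] -/
theorem stub_sectorModuloFacts :
    (∀ (p : ℕ) [Fact p.Prime] (B : AbelianVariety ℚ),
        Literature.AlgebraicGeometry.Motives.faltings_tate_bijective B B p) →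
    (∀ (p : ℕ) [Fact p.Prime] (B : AbelianVariety ℚ),
        Literature.AlgebraicGeometry.Motives.isSemisimpleRepresentation_rationalTateRep B p) →
    ordinaryReduction_tateModule_filtration →
    bcgp_switch_exists_modular_abelianSurface →
    weilPairing_rationalTateModule →
    ∀ (p : ℕ) [Fact p.Prime], p ≠ 2 → ∀ (k : Type) [Field k] [CharP k p] [IsAlgClosed k]
      [TopologicalSpace k] [DiscreteTopology k] (red : Valued.integer (PadicAlgCl p) →+* k)
      (σ σ' : FramedGaloisRep ℚ k 2),
      p = 3 → Switchable p k σ σ' → CruxAt p k red σ σ' := by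
  intro hF hS hST hBCGP hWeil p _ hp k _ _ _ _ _ red σ σ' hp3 hsw hA hA' hirr hirr' hdet hnc hw hcpt ι
  obtain ⟨ρw, hSw⟩ := hw
  obtain ⟨B, b, ρ₀, hfr, hdim, hord, hEnd, hsymp, hpair, hAut⟩ :=
    stub_switchToModularSurface hBCGP hWeil p hp3 k red σ σ' hsw
  have hirr₀ : ρ₀.toGaloisRep.IsIrreducible := stub_tateModuleIrreducible hF hS p B b ρ₀ hfr hEnd
  have hGr : ∀ v : HeightOneSpectrum (𝓞 ℚ), ((p : ℕ) : 𝓞 ℚ) ∈ v.asIdeal →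
      ρ₀.IsGreenbergOrdinaryOfShapeAt v ![0, 0, 1, 1] :=
    fun v hv => stub_tateModuleGreenberg hST p B b ρ₀ hfr hdim v hv (hord v hv)
  refine ⟨ρ₀, hirr₀, ⟨hsymp, fun v hv => ⟨hGr v hv, ?_⟩, hpair⟩, hAut hcpt ι⟩
  exact stub_distinguishedTransferLocal p hp k red ρw ρ₀ v hv
    (stub_charpolyCongruence p k red σ σ' ρw ρ₀ hSw.2.2 hpair) (hSw.2.1 v hv).2 (hGr v hv)

end Summit.Langlands.Langlands.Cruxes.StableYoshidaCongruence.LevelThreeWeierstrassSwitch
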